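/-
Copyright (c) 2026 the pub-hodgecm-mathlib formalisation cell (harness21).  Prover seat hodgecm-mathlib-K2E4-p01 (g3), Track B «K2-LIT» ∕ h413
(stmt-HodgeConjecture-24833), socket #22S road, F-B re-cut (RK2_v): (R1) the `GL₃` matrix algebra of the SEMISIMPLE CONE `(g − z)(g − c) = 0`.  2026-09-04.
-/
import Literature.NumberTheory.Automorphic.UnitaryGroupConstantTermSplit     -- ★ `Zelevinsky1980.lastBlockLabel` (the `(2,1)` labelling), `reindexGL`, `blockDiagGL`
import HarnessLib

/-!
# h413 ∕ Track B «K2-LIT» — (R1) CONE ALGEBRA IN `GL₃`: the semisimple cone `Z = {g : (g − z·1)(g − c·1) = 0}` contains every `k (m_z u) k⁻¹`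
# (`m_z = diag(z, z, c)`, `u` in the `(2,1)` unipotent radical, `k` arbitrary) and misses the unipotent shell point `y = (z 0 0; z z 0; 0 0 c)`

Cell `pub/hodgecm-mathlib`, crux H413 = `stmt-HodgeConjecture-24833` (supports-only).  The rank-two pair `hRK` of ★ p855314 for socket #22S is built (next
file `K2E4SplitTransferRankTwo`) from the test function `f₂ = 1_{e′⁻¹(y·K(ϖ^N))}` on `G′_v ≅ GL₃(L_w)`: its split transfer `τ_v·f̄₂^P` VANISHES at the centre
`z_v` because the constant-term integrand `1_D(k m_z u k⁻¹)` lives on the closed cone `Z`, which a small neighbourhood `D` of `y` avoids, while it CHARGES the deepest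
shells of the (GS) ray, whose Levi images tend to `y`.  THIS FILE is the field-level matrix algebra (any field `F`):
* `reindex_fromBlocks_two_one` — the `(2,1)` block-diagonal matrix as a `3 × 3` literal;
* `unipotent_apply_eq` — the seven fixed entries of a `(2,1)`-unipotent matrix (★ `mem_unipotentRadicalGL_iff_apply`'s condition);
* **`cone_diag_mul_unipotent`** — `(m_z u − z)(m_z u − c) = 0`;  **`cone_conj`** — `(KGK′ − z)(KGK′ − c) = K (G − z)(G − c) K′` for `KK′ = K′K = 1`;
* **`shell_not_cone`** — `(y − z)(y − c) ≠ 0` for `y = (z 0 0; z z 0; 0 0 c)`, `z ≠ 0`, `z ≠ c` (its `(1,0)` entry is `z(z − c)`).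

HONEST LABEL: HC_CM is proved only modulo the 7 printed citations (2 remaining named inputs: hLiu418 = `stmt-HodgeConjecture-24832`,
h413 = `stmt-HodgeConjecture-24833`) until rung 0 closes; this file is elementary linear algebra and moves no counter by itself.

## References
* [Rogawski1990] J. D. Rogawski, *Automorphic Representations of Unitary Groups in Three Variables* (1990), §4.13 p. 64 (the `(2,1)` parabolic), §8.1 p. 114.
* [BernsteinZelevinsky1977] I. N. Bernstein, A. V. Zelevinsky, *Induced representations of reductive p-adic groups I*, Ann. Sci. ÉNS 10 (1977), §2.1.
-/

set_option autoImplicit false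
set_option linter.dupNamespace false

open Matrix
open Literature.NumberTheory.Automorphic

namespace Summit.HodgeConjecture.HodgeConjecture.Cruxes.H413.K2E4SplitTransferConeAlgebra

variable {F : Type*} [Field F]

/-- **The `(2,1)` block-diagonal matrix as a `3 × 3` literal**: `reindex (fromBlocks A 0 0 B) = (A₀₀ A₀₁ 0; A₁₀ A₁₁ 0; 0 0 B₀₀)` along `finSumFinEquiv`.
[cite: BernsteinZelevinsky1977, §2.1] -/
theorem reindex_fromBlocks_two_one (A : Matrix (Fin 2) (Fin 2) F) (B : Matrix (Fin 1) (Fin 1) F) :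
    Matrix.reindex (finSumFinEquiv : Fin 2 ⊕ Fin 1 ≃ Fin 3) finSumFinEquiv (Matrix.fromBlocks A 0 0 B) =
      !![A 0 0, A 0 1, 0; A 1 0, A 1 1, 0; 0, 0, B 0 0] := by
  ext i j
  fin_cases i <;> fin_cases j <;> rfl

/-- **The seven fixed entries of a `(2,1)`-unipotent matrix** `N = (1 0 a; 0 1 b; 0 0 1)` (the condition of ★ `mem_unipotentRadicalGL_iff_apply` for the
labelling `Zelevinsky1980.lastBlockLabel 3`). [cite: BernsteinZelevinsky1977, §2.1] [cite: Rogawski1990, §4.13 p. 64] -/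
theorem unipotent_apply_eq (N : Matrix (Fin 3) (Fin 3) F)
    (h : ∀ i j : Fin 3, Zelevinsky1980.lastBlockLabel 3 j ≤ Zelevinsky1980.lastBlockLabel 3 i → N i j = (1 : Matrix (Fin 3) (Fin 3) F) i j) :
    N 0 0 = 1 ∧ N 0 1 = 0 ∧ N 1 0 = 0 ∧ N 1 1 = 1 ∧ N 2 0 = 0 ∧ N 2 1 = 0 ∧ N 2 2 = 1 := by
  refine ⟨?_, ?_, ?_, ?_, ?_, ?_, ?_⟩
  all_goals first
    | (rw [h _ _ (by decide)]; simp)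

/-- **The centre's `K U K`-orbit lies on the cone**: for `m = diag(z, z, c)` and a `(2,1)`-unipotent `N`, `(m N − z·1)(m N − c·1) = 0`
(`m N = (z 0 za; 0 z zb; 0 0 c)`). [cite: Rogawski1990, §8.1 p. 114] -/
theorem cone_diag_mul_unipotent (z c : F) {M N : Matrix (Fin 3) (Fin 3) F} (hM : M = !![z, 0, 0; 0, z, 0; 0, 0, c])
    (h00 : N 0 0 = 1) (h01 : N 0 1 = 0) (h10 : N 1 0 = 0) (h11 : N 1 1 = 1) (h20 : N 2 0 = 0) (h21 : N 2 1 = 0) (h22 : N 2 2 = 1) :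
    (M * N - z • (1 : Matrix (Fin 3) (Fin 3) F)) * (M * N - c • (1 : Matrix (Fin 3) (Fin 3) F)) = 0 := by
  have hN : N = !![1, 0, N 0 2; 0, 1, N 1 2; 0, 0, 1] := by
    ext i j
    fin_cases i <;> fin_cases j <;> simp [h00, h01, h10, h11, h20, h21, h22]
  rw [hM, hN]
  ext i j
  fin_cases i <;> fin_cases j <;> simp [Matrix.mul_apply, Fin.sum_univ_three, Matrix.one_apply]

/-- **Conjugation preserves the cone**: `(K G K′ − z·1)(K G K′ − c·1) = K (G − z·1)(G − c·1) K′` whenever `K K′ = 1` and `K′ K = 1`.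
[cite: Rogawski1990, §8.1 p. 114] -/
theorem cone_conj (z c : F) (K K' G : Matrix (Fin 3) (Fin 3) F) (hKK' : K * K' = 1) (hK'K : K' * K = 1) :
    (K * G * K' - z • (1 : Matrix (Fin 3) (Fin 3) F)) * (K * G * K' - c • (1 : Matrix (Fin 3) (Fin 3) F)) =
      K * ((G - z • (1 : Matrix (Fin 3) (Fin 3) F)) * (G - c • (1 : Matrix (Fin 3) (Fin 3) F))) * K' := by
  have h1 : K * G * K' - z • (1 : Matrix (Fin 3) (Fin 3) F) = K * (G - z • 1) * K' := by
    rw [Matrix.mul_sub, Matrix.sub_mul, Matrix.mul_smul, Matrix.mul_one, Matrix.smul_mul, hKK']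
  have h2 : K * G * K' - c • (1 : Matrix (Fin 3) (Fin 3) F) = K * (G - c • 1) * K' := by
    rw [Matrix.mul_sub, Matrix.sub_mul, Matrix.mul_smul, Matrix.mul_one, Matrix.smul_mul, hKK']
  rw [h1, h2]
  calc K * (G - z • 1) * K' * (K * (G - c • 1) * K')
      = K * (G - z • 1) * (K' * K) * (G - c • 1) * K' := by simp only [Matrix.mul_assoc]
    _ = K * ((G - z • 1) * (G - c • 1)) * K' := by rw [hK'K, Matrix.mul_one]; simp only [Matrix.mul_assoc]

/-- **The unipotent shell point is OFF the cone**: `y = (z 0 0; z z 0; 0 0 c)` has `((y − z·1)(y − c·1))₁₀ = z(z − c) ≠ 0` for `z ≠ 0`, `z ≠ c`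
(`y` is conjugate to `z·(1 1; 0 1) ⊕ c`, not semisimple). [cite: Rogawski1990, §8.1 p. 116] -/
theorem shell_not_cone {z c : F} (hz : z ≠ 0) (hzc : z ≠ c) {Y : Matrix (Fin 3) (Fin 3) F} (hY : Y = !![z, 0, 0; z, z, 0; 0, 0, c]) :
    (Y - z • (1 : Matrix (Fin 3) (Fin 3) F)) * (Y - c • (1 : Matrix (Fin 3) (Fin 3) F)) ≠ 0 := by
  intro h
  have h10 := congrArg (fun M : Matrix (Fin 3) (Fin 3) F => M 1 0) h
  simp only [hY, Matrix.mul_apply, Fin.sum_univ_three, Matrix.sub_apply, Matrix.smul_apply, Matrix.one_apply, Matrix.zero_apply,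
    Matrix.of_apply, Matrix.cons_val', Matrix.cons_val_zero, Matrix.cons_val_one, Matrix.cons_val_two, Matrix.cons_val_fin_one,
    smul_eq_mul] at h10
  have : z * (z - c) = 0 := by
    rw [← h10]
    simp
  rcases mul_eq_zero.1 this with h1 | h1
  · exact hz h1
  · exact hzc (sub_eq_zero.1 h1)

end Summit.HodgeConjecture.HodgeConjecture.Cruxes.H413.K2E4SplitTransferConeAlgebra
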